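import Mathlib
import HarnessLib
import Summits.HubbardSuperconductivity.HubbardSuperconductivity.Theorems.KLProgrammeC4aBubbleSwapSymmetry
import Summits.HubbardSuperconductivity.HubbardSuperconductivity.Theorems.KLProgrammeC4aCoMovingJetsL1Theta

/-!
# Route `KLProgramme` — crux C4a, S3 brick (B4) «(U1)-HYBRID», «SWAP-BY-SYMMETRY» part 2: the `CoMovingJetsL1Theta` bookkeeping of the pp vertex
# `(k, q) ↦ 𝐁_P(k + q)` from its four symmetric pieces — dominators `2a_A + a_M + 2a_F + a_FF`, NO swap piece, NO loop-far/partner-near piece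

Cell `gate-hubbard-kl`, seat hubbard-kl-k3c3-p3 (g38; row «implicit-function / monotonicity route for μ(n)»).  Companion of `…C4aBubbleSwapSymmetry` (located #12
«SWAP-PIECE-UMK», the (γ′) showing) for the (C)-closer lane / the `M_i` assembly (stub (C) `stub_twoLeg_curvature` of `KLRegimeEngineV17F2`,
stmt-HubbardSuperconductivity-20437), memo HOME/hubbard-kl-k3c3-p3/SWAP-BY-SYMMETRY.md.
* `CoMovingJetsL1Theta.congr_vertex`;
* **`coMovingJetsL1Theta_of_symmetric_pieces`** (abstract symmetric `P = A + Aᵀ + M`, continuous weight `w`): `CoMovingJetsL1Theta` dominators `a_A, a_M, a_F, a_FF`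
  for the vertices `𝐁_{w⊗w·A}`, `𝐁_{w⊗w·M}`, `𝐁_{w⊗(1−w)·P}`, `𝐁_{(1−w)⊗(1−w)·P}` (zone integrals at `k + q`, cast to `ℂ`) give `‖2‖a_A + a_M + ‖2‖a_F + a_FF` for `𝐁_P`
  (`CoMovingJetsL1Theta.add/const_smul` + the two zone identities of part 1);
* **`coMovingJetsL1Theta_ppTrueKernel_of_pieces`** — the same for `P = ppTrueKernel βT Λ`, `A = ppFarKernelS βT Λ κ lo`, `M = ppMidKernelS βT Λ κ lo`.
Bookkeeping on landed objects; nothing about the model's sizes; nothing asserts (C), K3, the window or superconductivity.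
References: FST II CPAM 51 (1998) §3 [cite: FeldmanSalmhoferTrubowitz1998]; BGM 2006 §2.4 (2.36) [cite: BenfattoGiulianiMastropietro2006].
-/

noncomputable section

namespace Summit.HubbardSuperconductivity.HubbardSuperconductivity.Theorems.C4a

set_option linter.dupNamespace false -- summit = problem name (single-conjunct summit), D-0017

open Real Set Filter MeasureTheory
open scoped Topology ContDiff
open Literature.MathematicalPhysics.QuantumLattice Literature.MathematicalPhysics.QuantumLattice.BandSectorCounting Literature.Probability.LatticeModels
open Summit.HubbardSuperconductivity.HubbardSuperconductivity.Theorems.KLRegimeSplit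
open Summit.HubbardSuperconductivity.HubbardSuperconductivity.Theorems.DispersionFlow
open Summit.HubbardSuperconductivity.HubbardSuperconductivity.Theorems.PerturbedFermiCurve

/-! ## §1 The abstract bookkeeping -/

section Jets

variable (μ : ℝ) (K : TrigPolyC4v)

/-- Congruence: `CoMovingJetsL1Theta` only depends on the vertex function. -/
theorem CoMovingJetsL1Theta.congr_vertex {N : ℕ} {a : ℝ → ℕ → ℝ × ℝ → ℝ} {r : ℝ} {V₁ V₂ : Momentum → Momentum → ℂ}
    (h : CoMovingJetsL1Theta N a r μ K V₁) (hV : ∀ k q, V₁ k q = V₂ k q) : CoMovingJetsL1Theta N a r μ K V₂ := by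
  have : V₁ = V₂ := funext fun k => funext fun q => hV k q
  subst this
  exact h

/-- **THE pp VERTEX FROM ITS SYMMETRIC PIECES**: write `𝐁_X(R) := ∫_{(−π,π)²} X(e_K q̂, e_K(R − q̂))` (real, cast to `ℂ`).  If `P` is symmetric with
`P = A + Aᵀ + M`, and the four vertices `(k,q) ↦ 𝐁_{w⊗w·A}(k+q)`, `𝐁_{w⊗w·M}(k+q)`, `𝐁_{w⊗(1−w)·P}(k+q)`, `𝐁_{(1−w)⊗(1−w)·P}(k+q)` carry `CoMovingJetsL1Theta`
dominators `a_A, a_M, a_F, a_FF`, then `(k,q) ↦ 𝐁_P(k+q)` carries `2a_A + a_M + 2a_F + a_FF` — the swap piece and the loop-far/partner-near piece never appear. -/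
theorem coMovingJetsL1Theta_of_symmetric_pieces {P A M : ℝ → ℝ → ℝ} {w : ℝ → ℝ} (hw : Continuous w)
    (hP : Continuous fun p : ℝ × ℝ => P p.1 p.2) (hA : Continuous fun p : ℝ × ℝ => A p.1 p.2) (hM : Continuous fun p : ℝ × ℝ => M p.1 p.2)
    (hPsymm : ∀ e u, P e u = P u e) (hPAM : ∀ e u, P e u = A e u + A u e + M e u)
    {N : ℕ} {r : ℝ} {aA aM aF aFF : ℝ → ℕ → ℝ × ℝ → ℝ}
    (hJA : CoMovingJetsL1Theta N aA r μ K fun k q => ((∫ p in Ioo (-π) π ×ˢ Ioo (-π) π, w (frameLevel μ K (WithLp.toLp 2 ![p.1, p.2])) *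
        w (frameLevel μ K (k + q - WithLp.toLp 2 ![p.1, p.2])) *
        A (frameLevel μ K (WithLp.toLp 2 ![p.1, p.2])) (frameLevel μ K (k + q - WithLp.toLp 2 ![p.1, p.2])) : ℝ) : ℂ))
    (hJM : CoMovingJetsL1Theta N aM r μ K fun k q => ((∫ p in Ioo (-π) π ×ˢ Ioo (-π) π, w (frameLevel μ K (WithLp.toLp 2 ![p.1, p.2])) *
        w (frameLevel μ K (k + q - WithLp.toLp 2 ![p.1, p.2])) *
        M (frameLevel μ K (WithLp.toLp 2 ![p.1, p.2])) (frameLevel μ K (k + q - WithLp.toLp 2 ![p.1, p.2])) : ℝ) : ℂ))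
    (hJF : CoMovingJetsL1Theta N aF r μ K fun k q => ((∫ p in Ioo (-π) π ×ˢ Ioo (-π) π, w (frameLevel μ K (WithLp.toLp 2 ![p.1, p.2])) *
        (1 - w (frameLevel μ K (k + q - WithLp.toLp 2 ![p.1, p.2]))) *
        P (frameLevel μ K (WithLp.toLp 2 ![p.1, p.2])) (frameLevel μ K (k + q - WithLp.toLp 2 ![p.1, p.2])) : ℝ) : ℂ))
    (hJFF : CoMovingJetsL1Theta N aFF r μ K fun k q => ((∫ p in Ioo (-π) π ×ˢ Ioo (-π) π, (1 - w (frameLevel μ K (WithLp.toLp 2 ![p.1, p.2]))) *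
        (1 - w (frameLevel μ K (k + q - WithLp.toLp 2 ![p.1, p.2]))) *
        P (frameLevel μ K (WithLp.toLp 2 ![p.1, p.2])) (frameLevel μ K (k + q - WithLp.toLp 2 ![p.1, p.2])) : ℝ) : ℂ)) :
    CoMovingJetsL1Theta N (fun θ i p => ‖(2 : ℂ)‖ * aA θ i p + aM θ i p + ‖(2 : ℂ)‖ * aF θ i p + aFF θ i p) r μ K fun k q =>
      ((∫ p in Ioo (-π) π ×ˢ Ioo (-π) π,
        P (frameLevel μ K (WithLp.toLp 2 ![p.1, p.2])) (frameLevel μ K (k + q - WithLp.toLp 2 ![p.1, p.2])) : ℝ) : ℂ) := by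
  have h := (((hJA.const_smul 2).add hJM).add (hJF.const_smul 2)).add hJFF
  refine CoMovingJetsL1Theta.congr_vertex μ K h fun k q => ?_
  have e1 := zoneBox_eq_symmetricCutoff_add_complement μ K hw hP hPsymm (k + q)
  have e2 := zoneBox_symmetricCutoff_eq_two_far_add_mid μ K hw hA hM hPAM (k + q)
  simp only
  rw [e1, e2]
  push_cast
  ring

end Jets

/-! ## §2 The concrete kernel -/

section Concrete

variable (μ : ℝ) (K : TrigPolyC4v) {βT Λ : ℝ} (hβ : 0 < βT) (κ : ℝ → ℝ) (hκ : Continuous κ) {lo : ℝ} (hlo : 0 < lo)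
include hβ hκ hlo

/-- **`CoMovingJetsL1Theta` for the true pp vertex from its four symmetric pieces** (concrete form of §4). [cite: FeldmanSalmhoferTrubowitz1998, §3] -/
theorem coMovingJetsL1Theta_ppTrueKernel_of_pieces {w : ℝ → ℝ} (hw : Continuous w) {N : ℕ} {r : ℝ} {aA aM aF aFF : ℝ → ℕ → ℝ × ℝ → ℝ}
    (hJA : CoMovingJetsL1Theta N aA r μ K fun k q => ((∫ p in Ioo (-π) π ×ˢ Ioo (-π) π, w (frameLevel μ K (WithLp.toLp 2 ![p.1, p.2])) *
        w (frameLevel μ K (k + q - WithLp.toLp 2 ![p.1, p.2])) *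
        ppFarKernelS βT Λ κ lo (frameLevel μ K (WithLp.toLp 2 ![p.1, p.2])) (frameLevel μ K (k + q - WithLp.toLp 2 ![p.1, p.2])) : ℝ) : ℂ))
    (hJM : CoMovingJetsL1Theta N aM r μ K fun k q => ((∫ p in Ioo (-π) π ×ˢ Ioo (-π) π, w (frameLevel μ K (WithLp.toLp 2 ![p.1, p.2])) *
        w (frameLevel μ K (k + q - WithLp.toLp 2 ![p.1, p.2])) *
        ppMidKernelS βT Λ κ lo (frameLevel μ K (WithLp.toLp 2 ![p.1, p.2])) (frameLevel μ K (k + q - WithLp.toLp 2 ![p.1, p.2])) : ℝ) : ℂ))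
    (hJF : CoMovingJetsL1Theta N aF r μ K fun k q => ((∫ p in Ioo (-π) π ×ˢ Ioo (-π) π, w (frameLevel μ K (WithLp.toLp 2 ![p.1, p.2])) *
        (1 - w (frameLevel μ K (k + q - WithLp.toLp 2 ![p.1, p.2]))) *
        ppTrueKernel βT Λ (frameLevel μ K (WithLp.toLp 2 ![p.1, p.2])) (frameLevel μ K (k + q - WithLp.toLp 2 ![p.1, p.2])) : ℝ) : ℂ))
    (hJFF : CoMovingJetsL1Theta N aFF r μ K fun k q => ((∫ p in Ioo (-π) π ×ˢ Ioo (-π) π, (1 - w (frameLevel μ K (WithLp.toLp 2 ![p.1, p.2]))) *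
        (1 - w (frameLevel μ K (k + q - WithLp.toLp 2 ![p.1, p.2]))) *
        ppTrueKernel βT Λ (frameLevel μ K (WithLp.toLp 2 ![p.1, p.2])) (frameLevel μ K (k + q - WithLp.toLp 2 ![p.1, p.2])) : ℝ) : ℂ)) :
    CoMovingJetsL1Theta N (fun θ i p => ‖(2 : ℂ)‖ * aA θ i p + aM θ i p + ‖(2 : ℂ)‖ * aF θ i p + aFF θ i p) r μ K fun k q =>
      ((∫ p in Ioo (-π) π ×ˢ Ioo (-π) π,
        ppTrueKernel βT Λ (frameLevel μ K (WithLp.toLp 2 ![p.1, p.2])) (frameLevel μ K (k + q - WithLp.toLp 2 ![p.1, p.2])) : ℝ) : ℂ) :=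
  coMovingJetsL1Theta_of_symmetric_pieces μ K hw (continuous_ppTrueKernel_comp hβ Λ continuous_fst continuous_snd)
    (continuous_ppFarKernelS₂ hβ κ hκ hlo) (continuous_ppMidKernelS₂ hβ κ hκ hlo) (fun e u => ppTrueKernel_symm βT Λ e u)
    (fun e u => ppTrueKernel_eq_farS_add_swap_add_midS κ hlo e u) hJA hJM hJF hJFF

end Concrete

end Summit.HubbardSuperconductivity.HubbardSuperconductivity.Theorems.C4a

end
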